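import Summits.QuantumFields.YangMills.Theorems.BalabanUVNodesN15CurvedCubeTransplantLaplacian
import HarnessLib

/-!
# Route «BalabanUVNodes» (cluster K4 «SpineRates»), Track-A DAG node N15 = NE2, BACKGROUND LAYER — THE COVARIANT EDITION OF THE TRANSPLANT BOOKKEEPING ON THE PRODUCT CARRIER
# `X × ι`: matrix coefficient operators `M_C` pass the transplant EXACTLY (coefficients read through the base chart), Bałaban's covariant Laplacian `Δ_R` (3.50) in transporter form
# agrees with the transplanted cube one behind a cut one step inside the window, and the cube's localized-inverse identity `M_χ′ ∘ (Δ_{R′} + W′) ∘ X = M_χ′` (dag-n15-w3's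
# `mulOp_comp_covLapM_add_comp_dressed`) TRANSPLANTS: `M_h ∘ (Δ_R + W) ∘ (ε X ρ) = M_h` on the global lattice

Cell `pub-ymgap`, WIDTH SEAT `pub-ymgap-dag-n15-w2` (director-ym №197 ∕ HUMAN RULING D-0149), generation 3, file 7 (covariant sequel of files 2∕3 = dag-n15-w3 g3's located piece (c) and
its consumer shape l.29136 «`M_hΔ_glob(transplant G) = M_h + E`»).  `bears_on: R4∕N15 · K3⁷ SpineGivenEndpointR13SepCoPH (stmt-QuantumFields-20544)`.  Filed `--kind proof --supports
stmt-QuantumFields-20544 --as helper` — COUNT-NEUTRAL; theorems only (0 `def`, 0 `sorry`).  Imports BY NAME this seat's file 3 `…N15CurvedCubeTransplantLaplacian` (p607138: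
`mulOp_comp_transplant_eq_mulOp_of_cut`, `apply_eq_of_mulOp_comp_eq`; through it file 11 `transplant`∕`extendOp`∕`restrictOp`, n15-b∕c `BackgroundLayer.covLapM`, `covLapM_apply`,
`MatrixSpecies.mmulOp`, `liftMap`); nothing re-declared.

WHY.  On the product carrier `X × ι` (matrix-valued fields read as scalar fields) the cube's and the global operators of the lineage are Bałaban's covariant Laplacian in transporter
form `Δ_R` ([Balaban1985BackgroundPropagators] (3.50) p. 400; the tree's `covLapM τ η R`) plus matrix coefficient operators `M_C` (`mmulOp`), and dag-n15-w3's cube device delivers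
`hloc` in the form `M_χ ∘ (covLapM τ η U + W) ∘ X = M_χ` (`mulOp_comp_covLapM_add_comp_dressed`, p604636 lineage).  Files 2∕3 treated scalar shifts and `Gluing.lapOp`; THIS FILE gives the
same three statements for the covariant objects with the window a FIBRE-SATURATED set of `X × ι` and the chart `liftMap e₁ ι` of a base chart `e₁` (dag-n15-w5's `…N15TorusBoxCharts`
supplies exactly such windows∕charts on King's tori): (i) `M_C ∘ εTρ = ε(M_{C′}T)ρ` when `C = C′ ∘ e₁` on the window (EXACT, no cut — coefficients are block-diagonal in the lattice
factor); (ii) `M_h ∘ Δ_R ∘ εTρ = M_h ∘ ε(Δ_{R′}T)ρ` when `R = R′ ∘ e₁` on the window, the base shifts are intertwined by `e₁` inside the window, and `h = 0` on the one-step layer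
(pointwise from `covLapM_apply`); (iii) the transplanted covariant `hloc`, with and without a cube-side defect slot.

WHAT: §1 `mem_of_sat` helpers, ★★ `mmulOp_comp_transplant_liftMap`; §2 ★★ `mulOp_comp_covLapM_comp_transplant`; §3 ★★★ `mulOp_comp_covLapM_add_comp_transplant_of_hloc`
(`M_χ′ ∘ (Δ_{R′} + W′) ∘ G = M_χ′` on the cube, `M_h ∘ W ∘ εGρ = M_h ∘ ε(W′G)ρ`, cut one step inside and inside `{χ′ ∘ e = 1}` ⟹ `M_h ∘ (Δ_R + W) ∘ (εGρ) = M_h`), ★★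
`mulOp_comp_covLapM_add_comp_transplant_of_hloc_defect` (`… = M_χ′ + D` ⟹ `… = M_h + M_h ∘ εDρ`).

HONEST FRAMING ∕ LIMITS.  Finite-lattice support bookkeeping (pointwise case analysis over `covLapM_apply` ∕ `mmulOp_apply`); ONE grid; window∕chart geometry, coefficient∕transporter
compatibilities through the base chart (the cube's `U` is the global `U` read through the chart — DISPLAYED, the consumer's restriction), the cut's support and the cube's `hloc` are
DISPLAYED hypotheses; nothing of [B6]∕[B9] asserted ((3.50)–(3.53) p. 400, (2.90)–(2.93) p. 239, (2.133) p. 247 cited as SHAPES).  NE2⁺ NOT PRINTED ∕ NOT proved for d = 4; N15 NOT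
discharged; K3⁷ OPEN; counts UNMOVED (typed 28∕28 · discharged 5∕27, A 5∕28); one finite 𝕋⁴ at fixed ε — NOT infinite volume, NOT OS on ℝ⁴, NOT a mass gap, NOT Clay; R4 closes the
conditional finite-𝕋⁴ rung `BalabanLadder.UV` only.  Restate-immune (no Theses import).
-/

set_option autoImplicit false

noncomputable section
open scoped BigOperators
open Finset

namespace Summit.QuantumFields.YangMills.BalabanUVNodes.N15.CurvedSpecies

open Literature.MathematicalPhysics.QuantumFieldTheory.Balaban1983to89
open Literature.MathematicalPhysics.QuantumFieldTheory.Balaban1983to89.B6Prop26ReachTransplant (restrictOp extendOp transplant transplant_apply restrictOp_apply_of_injOn)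
open Literature.MathematicalPhysics.QuantumFieldTheory.Balaban1983to89.B6Prop26Gluing (mulOp mulOp_apply)
open Literature.MathematicalPhysics.QuantumFieldTheory.Balaban1983to89.T4EtaRateCoeffDefect (pull pull_apply)
open Summit.QuantumFields.YangMills.BalabanUVNodes.N15.MatrixSpecies (mmulOp mmulOp_apply liftMap)
open Summit.QuantumFields.YangMills.BalabanUVNodes.N15.BackgroundLayer (covLapM covLapM_apply)

variable {X X' ι J : Type} [DecidableEq X] [DecidableEq X'] [DecidableEq ι] [Fintype ι] [Fintype J]
variable (W : Finset (X × ι)) (e₁ : X → X') (T : Module.End ℝ (X' × ι → ℝ))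

/-! ## §1 Matrix coefficient operators pass the transplant exactly -/

section Coefficient

omit [DecidableEq X] [DecidableEq X'] [DecidableEq ι] [Fintype ι] [Fintype J] in
/-- In a fibre-saturated window, membership does not depend on the component index. [folklore] -/
theorem mem_iff_of_sat (hsat : ∀ x i j, (x, i) ∈ W → (x, j) ∈ W) (x : X) (i j : ι) : (x, i) ∈ W ↔ (x, j) ∈ W :=
  ⟨hsat x i j, hsat x j i⟩

omit [Fintype J] in
/-- ★★ **A MATRIX COEFFICIENT OPERATOR PAST THE TRANSPLANT**: window `W ⊆ X × ι` fibre-saturated, chart `liftMap e₁ ι`, coefficients `C(x) = C′(e₁x)` for `x` in the window's base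
⟹ `M_C ∘ (εTρ) = ε(M_{C′} ∘ T)ρ` (EXACT, no cut: `M_C` is block-diagonal in the lattice factor). [cite: Balaban1985BackgroundPropagators, (3.50)–(3.52) p.400 (matrix coefficients `R(U)`, `ad`: shape); Balaban1984PropagatorsII, (2.90)–(2.91) p.239 (shape)] -/
theorem mmulOp_comp_transplant_liftMap (hsat : ∀ x i j, (x, i) ∈ W → (x, j) ∈ W) {C : X → Matrix ι ι ℝ} {C' : X' → Matrix ι ι ℝ}
    (hC : ∀ x i, (x, i) ∈ W → C x = C' (e₁ x)) :
    mmulOp C ∘ₗ transplant W (liftMap e₁ ι) T = transplant W (liftMap e₁ ι) (mmulOp C' ∘ₗ T) := by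
  refine LinearMap.ext fun f => funext fun p => ?_
  obtain ⟨x, i⟩ := p
  simp only [LinearMap.comp_apply, mmulOp_apply, transplant_apply, liftMap]
  by_cases hx : (x, i) ∈ W
  · rw [if_pos hx, hC x i hx]
    exact Finset.sum_congr rfl fun j _ => by rw [if_pos (hsat x i j hx)]
  · rw [if_neg hx]
    exact Finset.sum_eq_zero fun j _ => by rw [if_neg (fun hj => hx (hsat x j i hj)), mul_zero]

end Coefficient

/-! ## §2 The covariant Laplacian in transporter form past the transplant behind a cut -/

section Covariant

variable (τ : J → X ≃ X) (τ' : J → X' ≃ X') (η : ℝ)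

omit [DecidableEq X] [DecidableEq X'] [DecidableEq ι] [Fintype ι] [Fintype J] in
/-- Chart compatibility read backwards: `e₁(τ_μ⁻¹x) = τ′_μ⁻¹(e₁x)` when `x` and `τ_μ⁻¹x` carry window fibres. [folklore] -/
theorem chart_symm_compat {μ : J} (hτ : ∀ x i, (x, i) ∈ W → (τ μ x, i) ∈ W → e₁ (τ μ x) = τ' μ (e₁ x)) {x : X} {i : ι}
    (hxi : ((τ μ).symm x, i) ∈ W) (hx : (x, i) ∈ W) : e₁ ((τ μ).symm x) = (τ' μ).symm (e₁ x) := by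
  have h := hτ ((τ μ).symm x) i hxi (by rwa [Equiv.apply_symm_apply])
  rw [Equiv.apply_symm_apply] at h
  rw [h, Equiv.symm_apply_apply]

/-- ★★ **BAŁABAN's COVARIANT LAPLACIAN (3.50) PAST THE TRANSPLANT BEHIND A CUT.**  Window `W ⊆ X × ι` fibre-saturated, chart `liftMap e₁ ι`, base shifts `τ_μ` (global) and `τ′_μ` (cube)
intertwined by `e₁` inside the window's base, transporters `R_b(x) = R′_b(e₁x)` for `x` in the window's base, and a cut `h = 0` off `W` and on `{(τ_μp₁, p₂) ∉ W} ∪ {(τ_μ⁻¹p₁, p₂) ∉ W}` (one step inside, every direction).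
Then `M_h ∘ Δ_R ∘ (εTρ) = M_h ∘ ε(Δ_{R′} ∘ T)ρ`, `Δ_R = covLapM τ η R`, `Δ_{R′} = covLapM τ′ η R′` (EXACT; pointwise from `covLapM_apply`).
[cite: Balaban1985BackgroundPropagators, (3.50) p.400; Balaban1984PropagatorsII, p.238 (T_□), (2.133) p.247 (shapes)] -/
theorem mulOp_comp_covLapM_comp_transplant (hsat : ∀ x i j, (x, i) ∈ W → (x, j) ∈ W)
    (hτ : ∀ μ x i, (x, i) ∈ W → (τ μ x, i) ∈ W → e₁ (τ μ x) = τ' μ (e₁ x))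
    {R : J ⊕ J → X → Matrix ι ι ℝ} {R' : J ⊕ J → X' → Matrix ι ι ℝ} (hR : ∀ b x i, (x, i) ∈ W → R b x = R' b (e₁ x))
    {h : X × ι → ℝ} (hh0 : ∀ p, p ∉ W → h p = 0) (hh1 : ∀ μ p, ((τ μ p.1, p.2) ∉ W ∨ ((τ μ).symm p.1, p.2) ∉ W) → h p = 0) :
    mulOp h ∘ₗ covLapM τ η R ∘ₗ transplant W (liftMap e₁ ι) T = mulOp h ∘ₗ transplant W (liftMap e₁ ι) (covLapM τ' η R' ∘ₗ T) := by
  refine LinearMap.ext fun f => funext fun p => ?_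
  obtain ⟨x, i⟩ := p
  simp only [LinearMap.comp_apply, mulOp_apply]
  by_cases hx : (x, i) ∈ W
  swap
  · rw [hh0 (x, i) hx, zero_mul, zero_mul]
  by_cases hall : ∀ μ, (τ μ x, i) ∈ W ∧ ((τ μ).symm x, i) ∈ W
  swap
  · obtain ⟨μ, hμ⟩ := not_forall.mp hall
    rw [hh1 μ (x, i) (not_and_or.mp hμ), zero_mul, zero_mul]
  congr 1
  simp only [transplant_apply, LinearMap.comp_apply, covLapM_apply, liftMap, hx, if_true]
  congr 1
  refine Finset.sum_congr rfl fun μ _ => ?_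
  obtain ⟨hf, hb⟩ := hall μ
  rw [hR (Sum.inl μ) x i hx, hR (Sum.inr μ) x i hx, hτ μ x i hx hf, chart_symm_compat W e₁ τ τ' (fun y j hy hy' => hτ μ y j hy hy') hb hx]
  have e1 : ∀ j, (if ((τ μ) x, j) ∈ W then T (restrictOp W (liftMap e₁ ι) f) ((τ' μ) (e₁ x), j) else 0) = T (restrictOp W (liftMap e₁ ι) f) ((τ' μ) (e₁ x), j) :=
    fun j => if_pos (hsat _ i j hf)
  have e2 : ∀ j, (if ((τ μ).symm x, j) ∈ W then T (restrictOp W (liftMap e₁ ι) f) ((τ' μ).symm (e₁ x), j) else 0) = T (restrictOp W (liftMap e₁ ι) f) ((τ' μ).symm (e₁ x), j) :=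
    fun j => if_pos (hsat _ i j hb)
  simp only [e1, e2]

end Covariant

/-! ## §3 The covariant localized-inverse identity transplants -/

section Hloc

variable (τ : J → X ≃ X) (τ' : J → X' ≃ X') (η : ℝ)

/-- ★★★ **THE TRANSPLANTED COVARIANT `hloc`.**  A cube pair `G` with `M_χ′ ∘ (Δ_{R′} + W′) ∘ G = M_χ′` (dag-n15-w3's `mulOp_comp_covLapM_add_comp_dressed` at a live background);
window∕chart∕transporter∕shift compatibilities as in §2; the extra part compatible behind the cut (`M_h ∘ W ∘ εGρ = M_h ∘ ε(W′G)ρ`, e.g. §1 for a matrix coefficient); the cut `h = 0`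
on the one-step layer in every direction, `h = 0` off `W`, and `h p ≠ 0 ⟹ χ′(e p) = 1`; base chart giving an injective chart `liftMap e₁ ι` on `W`.  Then ON THE GLOBAL LATTICE
`M_h ∘ (Δ_R + W) ∘ (εGρ) = M_h` — EXACT. [cite: Balaban1985BackgroundPropagators, (3.50) p.400 (shape); Balaban1984PropagatorsII, (2.90)–(2.93) p.239, (2.36) p.229 (shapes, mechanism)] -/
theorem mulOp_comp_covLapM_add_comp_transplant_of_hloc (hinj : Set.InjOn (liftMap e₁ ι) ↑W) (hsat : ∀ x i j, (x, i) ∈ W → (x, j) ∈ W)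
    (hτ : ∀ μ x i, (x, i) ∈ W → (τ μ x, i) ∈ W → e₁ (τ μ x) = τ' μ (e₁ x))
    {R : J ⊕ J → X → Matrix ι ι ℝ} {R' : J ⊕ J → X' → Matrix ι ι ℝ} (hR : ∀ b x i, (x, i) ∈ W → R b x = R' b (e₁ x))
    (Wg : (X × ι → ℝ) →ₗ[ℝ] (X × ι → ℝ)) (Wc : (X' × ι → ℝ) →ₗ[ℝ] (X' × ι → ℝ)) {G : Module.End ℝ (X' × ι → ℝ)} {χ' : X' × ι → ℝ}
    (hloc : mulOp χ' ∘ₗ (covLapM τ' η R' + Wc) ∘ₗ G = mulOp χ')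
    {h : X × ι → ℝ} (hh0 : ∀ p, p ∉ W → h p = 0) (hh1 : ∀ μ p, ((τ μ p.1, p.2) ∉ W ∨ ((τ μ).symm p.1, p.2) ∉ W) → h p = 0)
    (hhχ : ∀ p, h p ≠ 0 → χ' (liftMap e₁ ι p) = 1) (hW : mulOp h ∘ₗ Wg ∘ₗ transplant W (liftMap e₁ ι) G = mulOp h ∘ₗ transplant W (liftMap e₁ ι) (Wc ∘ₗ G)) :
    mulOp h ∘ₗ (covLapM τ η R + Wg) ∘ₗ transplant W (liftMap e₁ ι) G = mulOp h := by
  have h1 : mulOp h ∘ₗ (covLapM τ η R + Wg) ∘ₗ transplant W (liftMap e₁ ι) G = mulOp h ∘ₗ transplant W (liftMap e₁ ι) ((covLapM τ' η R' + Wc) ∘ₗ G) := by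
    rw [LinearMap.add_comp, LinearMap.comp_add, mulOp_comp_covLapM_comp_transplant W e₁ G τ τ' η hsat hτ hR hh0 hh1, hW, LinearMap.add_comp, transplant_add, LinearMap.comp_add]
  rw [h1]
  have hloc' : mulOp χ' ∘ₗ ((covLapM τ' η R' + Wc) ∘ₗ G) = mulOp χ' := by rw [← LinearMap.comp_assoc]; exact hloc
  exact mulOp_comp_transplant_eq_mulOp_of_cut W (liftMap e₁ ι) hinj (apply_eq_of_mulOp_comp_eq hloc') hh0 hhχ

/-- ★★ **THE TRANSPLANTED COVARIANT `hloc` WITH A CUBE-SIDE DEFECT SLOT**: `M_χ′ ∘ (Δ_{R′} + W′) ∘ G = M_χ′ + D` (dag-n15-w3's `…_of_defect` ∕ `hasMaj_sandwichDefect` shape) ⟹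
`M_h ∘ (Δ_R + W) ∘ (εGρ) = M_h + M_h ∘ (εDρ)`; the slot's global letter is file 3's `hasMaj_mulOp_comp_transplant`. [cite: Balaban1985BackgroundPropagators, (3.50) p.400 (shape); Balaban1984PropagatorsII, (2.90)–(2.93) p.239 (shape)] -/
theorem mulOp_comp_covLapM_add_comp_transplant_of_hloc_defect (hinj : Set.InjOn (liftMap e₁ ι) ↑W) (hsat : ∀ x i j, (x, i) ∈ W → (x, j) ∈ W)
    (hτ : ∀ μ x i, (x, i) ∈ W → (τ μ x, i) ∈ W → e₁ (τ μ x) = τ' μ (e₁ x))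
    {R : J ⊕ J → X → Matrix ι ι ℝ} {R' : J ⊕ J → X' → Matrix ι ι ℝ} (hR : ∀ b x i, (x, i) ∈ W → R b x = R' b (e₁ x))
    (Wg : (X × ι → ℝ) →ₗ[ℝ] (X × ι → ℝ)) (Wc : (X' × ι → ℝ) →ₗ[ℝ] (X' × ι → ℝ)) {G D : Module.End ℝ (X' × ι → ℝ)} {χ' : X' × ι → ℝ}
    (hloc : mulOp χ' ∘ₗ (covLapM τ' η R' + Wc) ∘ₗ G = mulOp χ' + D)
    {h : X × ι → ℝ} (hh0 : ∀ p, p ∉ W → h p = 0) (hh1 : ∀ μ p, ((τ μ p.1, p.2) ∉ W ∨ ((τ μ).symm p.1, p.2) ∉ W) → h p = 0)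
    (hhχ : ∀ p, h p ≠ 0 → χ' (liftMap e₁ ι p) = 1) (hW : mulOp h ∘ₗ Wg ∘ₗ transplant W (liftMap e₁ ι) G = mulOp h ∘ₗ transplant W (liftMap e₁ ι) (Wc ∘ₗ G)) :
    mulOp h ∘ₗ (covLapM τ η R + Wg) ∘ₗ transplant W (liftMap e₁ ι) G = mulOp h + mulOp h ∘ₗ transplant W (liftMap e₁ ι) D := by
  have h1 : mulOp h ∘ₗ (covLapM τ η R + Wg) ∘ₗ transplant W (liftMap e₁ ι) G = mulOp h ∘ₗ transplant W (liftMap e₁ ι) ((covLapM τ' η R' + Wc) ∘ₗ G) := by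
    rw [LinearMap.add_comp, LinearMap.comp_add, mulOp_comp_covLapM_comp_transplant W e₁ G τ τ' η hsat hτ hR hh0 hh1, hW, LinearMap.add_comp, transplant_add, LinearMap.comp_add]
  -- behind the cut the transplant of `(Δ' + W′)G` is the transplant of `M_χ′ (Δ' + W′) G = M_χ′ + D`
  have hcutL : mulOp h ∘ₗ transplant W (liftMap e₁ ι) ((covLapM τ' η R' + Wc) ∘ₗ G) = mulOp h ∘ₗ transplant W (liftMap e₁ ι) (mulOp χ' ∘ₗ (covLapM τ' η R' + Wc) ∘ₗ G) := by
    refine LinearMap.ext fun f => funext fun p => ?_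
    simp only [LinearMap.comp_apply, mulOp_apply, transplant_apply]
    by_cases hp : p ∈ W
    · rw [if_pos hp, if_pos hp]
      by_cases hhp : h p = 0
      · rw [hhp, zero_mul, zero_mul]
      · rw [hhχ p hhp, one_mul]
    · rw [if_neg hp, if_neg hp]
  rw [h1, hcutL, hloc, transplant_add, LinearMap.comp_add,
    mulOp_comp_transplant_eq_mulOp_of_cut W (liftMap e₁ ι) hinj (S := mulOp χ') (χ' := χ') (fun g q hq => by simp only [mulOp_apply, hq, one_mul]) hh0 hhχ]

end Hloc

end Summit.QuantumFields.YangMills.BalabanUVNodes.N15.CurvedSpecies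

end
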